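import Summits.MatrixMultiplication.MatrixMultiplication.Theses.CharacteristicContinuity
import Literature.Computability.AlgebraicComplexity.OmegaScalarExtensionInvariance
import Literature.Computability.AlgebraicComplexity.MatrixMultiplicationExponentInf
import Literature.Computability.AlgebraicComplexity.CoppersmithWinograd1982Acceleration
import Literature.Computability.AlgebraicComplexity.FlatteningBound
import Literature.Computability.AlgebraicComplexity.MatMulRankLowerBoundsBlaserProofs
import HarnessLib

/-!
# CharacteristicContinuityTransfer — landing form (decomp-mm cell, lens 5, generation 7)

Proofs of the two open `provable-now` support items of the dormant route
`route-MatrixMultiplication-CharacteristicContinuity` (`Theses/CharacteristicContinuity.lean`):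

* `lefschetzUpperBound_holds : LefschetzUpperBound` — item `stmt-MatrixMultiplication-18041`,
  upper semicontinuity of `ω` at characteristic zero: `∀ ε > 0`, `ω(𝔽̄_p) ≤ ω(ℂ) + ε` for all large
  primes `p`;
* `converse_holds : Converse` — item `stmt-MatrixMultiplication-18042`: `ω(ℂ) = 2` implies both
  cruxes `LargeCharacteristicFast` (18040) and `ContinuityAtZero` (18039) of the route.

The route header proves these by the Lefschetz principle on Brent sentences (planner folder
`bc/CharTransfer.lean`, never landed).  The proofs here are MODEL-THEORY-FREE: take one optimal
rational decomposition of `⟨k,m,n⟩`, clear denominators (`D³·⟨k,m,n⟩_ℤ = ∑ W ⊗ U ⊗ V` over `ℤ`),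
reduce modulo every prime `p > D` and invert `D³` (`tensorRank_zmod_le_rat_eventually`, the
unconditional `≤`-half of item 18044 `FixedFormatContinuity` at every rectangular format, with
`R_ℚ` on the right), extend scalars `𝔽_p → 𝔽̄_p` (`tensorRank_matMulTensor_map_le`), and use
`ω(ℚ) = ω(ℂ)` (tree `omega_eq_omega_rat`, BCS1997 Cor. 15.18) to pick the near-optimal format.

References: [cite: BurgisserClausenShokrollahi1997, Cor. (15.18) and Chap. 15 introduction];
[cite: Blaser2013, Def. 5.1].
-/

set_option linter.dupNamespace false -- `MatrixMultiplication.MatrixMultiplication` (summit = problem, D-0017)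

noncomputable section

open Filter Finset
open Literature.Computability.AlgebraicComplexity
open Summit.MatrixMultiplication.MatrixMultiplication.Theses.CharacteristicContinuity

namespace Summit.MatrixMultiplication.MatrixMultiplication.Theorems.CharacteristicContinuityTransfer

/-! ## Reduction modulo large primes of an optimal rational scheme -/

/-- clearing one denominator: `(D / q.den) · q.num = D · q` when `q.den ∣ D`. -/
theorem cast_scale (q : ℚ) {D : ℕ} (h : q.den ∣ D) :
    ((((D / q.den : ℕ) : ℤ) * q.num : ℤ) : ℚ) = (D : ℚ) * q := by
  obtain ⟨k, hk⟩ := h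
  have hk' : D / q.den = k := by rw [hk]; exact Nat.mul_div_cancel_left k q.den_pos
  rw [hk', hk]
  push_cast
  rw [← Rat.mul_den_eq_num q]
  ring

/-- **K is a theorem** (rectangular formats): reduce an optimal rational decomposition of `⟨k,m,n⟩`
modulo every prime above the product `D` of its denominators (`D³·⟨k,m,n⟩_ℤ = ∑ W ⊗ U ⊗ V` over
`ℤ`, then invert `D³` modulo `p ∤ D`). [folklore] -/
theorem tensorRank_zmod_le_rat_eventually (k m n : ℕ) :
    ∀ᶠ p in atTop, p.Prime →
      tensorRank (matMulTensor (ZMod p) k m n) ≤ tensorRank (matMulTensor ℚ k m n) := by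
  classical
  obtain ⟨w, u, v, hdec⟩ := exists_triad_decomposition_tensorRank (matMulTensor ℚ k m n)
  -- a common denominator of all coordinates
  set Pw : ℕ := ∏ i, ∏ a, (w i a).den with hPw
  set Pu : ℕ := ∏ i, ∏ b, (u i b).den with hPu
  set Pv : ℕ := ∏ i, ∏ c, (v i c).den with hPv
  set D : ℕ := Pw * Pu * Pv with hD
  have hPw0 : 0 < Pw := prod_pos fun i _ => prod_pos fun a _ => (w i a).den_pos
  have hPu0 : 0 < Pu := prod_pos fun i _ => prod_pos fun b _ => (u i b).den_pos
  have hPv0 : 0 < Pv := prod_pos fun i _ => prod_pos fun c _ => (v i c).den_pos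
  have hD0 : 0 < D := Nat.mul_pos (Nat.mul_pos hPw0 hPu0) hPv0
  have hw : ∀ i a, (w i a).den ∣ D := fun i a =>
    (((dvd_prod_of_mem (fun a => (w i a).den) (mem_univ a)).trans
      (dvd_prod_of_mem (fun i => ∏ a, (w i a).den) (mem_univ i))).mul_right Pu).mul_right Pv
  have hu : ∀ i b, (u i b).den ∣ D := fun i b =>
    (((dvd_prod_of_mem (fun b => (u i b).den) (mem_univ b)).trans
      (dvd_prod_of_mem (fun i => ∏ b, (u i b).den) (mem_univ i))).mul_left Pw).mul_right Pv
  have hv : ∀ i c, (v i c).den ∣ D := fun i c =>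
    ((dvd_prod_of_mem (fun c => (v i c).den) (mem_univ c)).trans
      (dvd_prod_of_mem (fun i => ∏ c, (v i c).den) (mem_univ i))).mul_left (Pw * Pu)
  -- integer coordinates
  set W : Fin (tensorRank (matMulTensor ℚ k m n)) → Fin k × Fin n → ℤ :=
    fun i a => ((D / (w i a).den : ℕ) : ℤ) * (w i a).num
  set U : Fin (tensorRank (matMulTensor ℚ k m n)) → Fin k × Fin m → ℤ :=
    fun i b => ((D / (u i b).den : ℕ) : ℤ) * (u i b).num
  set V : Fin (tensorRank (matMulTensor ℚ k m n)) → Fin m × Fin n → ℤ :=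
    fun i c => ((D / (v i c).den : ℕ) : ℤ) * (v i c).num
  have hW : ∀ i a, ((W i a : ℤ) : ℚ) = (D : ℚ) * w i a := fun i a => cast_scale (w i a) (hw i a)
  have hU : ∀ i b, ((U i b : ℤ) : ℚ) = (D : ℚ) * u i b := fun i b => cast_scale (u i b) (hu i b)
  have hV : ∀ i c, ((V i c : ℤ) : ℚ) = (D : ℚ) * v i c := fun i c => cast_scale (v i c) (hv i c)
  -- the integer identity `∑ W ⊗ U ⊗ V = D³ · ⟨k,m,n⟩_ℤ`, entrywise
  have key : ∀ a b c, (∑ i, W i a * U i b * V i c : ℤ) =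
      ((D ^ 3 : ℕ) : ℤ) * matMulTensor ℤ k m n a b c := by
    intro a b c
    apply Int.cast_injective (α := ℚ)
    have h1 : (matMulTensor ℚ k m n) a b c = ∑ i, w i a * u i b * v i c := by
      conv_lhs => rw [hdec]
      rw [Finset.sum_apply, Finset.sum_apply, Finset.sum_apply]
      simp only [triad_apply]
    have h2 : ((matMulTensor ℤ k m n a b c : ℤ) : ℚ) = matMulTensor ℚ k m n a b c := by
      have := matMulTensor_map (Int.castRingHom ℚ) k m n
      exact congrFun (congrFun (congrFun this a) b) c
    push_cast
    simp only [hW, hU, hV, h2, h1, Finset.mul_sum]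
    exact Finset.sum_congr rfl fun i _ => by ring
  -- modulo every prime `p > D`
  refine (eventually_gt_atTop D).mono fun p hp hprime => ?_
  have hpD : ¬ p ∣ D := fun h => absurd (Nat.le_of_dvd hD0 h) (not_le.2 hp)
  have hcop : Nat.Coprime (D ^ 3) p :=
    ((Nat.Prime.coprime_iff_not_dvd hprime).2 fun h => hpD (hprime.dvd_of_dvd_pow h)).symm
  obtain ⟨E, hE⟩ : ∃ E : ZMod p, E * ((D ^ 3 : ℕ) : ZMod p) = 1 :=
    ⟨((ZMod.unitOfCoprime (D ^ 3) hcop)⁻¹ : (ZMod p)ˣ), by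
      rw [← ZMod.coe_unitOfCoprime (D ^ 3) hcop, Units.inv_mul]⟩
  set f := Int.castRingHom (ZMod p) with hf
  refine tensorRank_le_of_eq_sum (fun i a => E * f (W i a))
    (fun i b => f (U i b)) (fun i c => f (V i c)) ?_
  funext a b c
  rw [Finset.sum_apply, Finset.sum_apply, Finset.sum_apply]
  simp only [triad_apply]
  have h3 : ((matMulTensor ℤ k m n a b c : ℤ) : ZMod p) = matMulTensor (ZMod p) k m n a b c := by
    have := matMulTensor_map f k m n
    exact congrFun (congrFun (congrFun this a) b) c
  have h4 : (∑ i, f (W i a) * f (U i b) * f (V i c)) =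
      ((D ^ 3 : ℕ) : ZMod p) * matMulTensor (ZMod p) k m n a b c := by
    have := congrArg (fun z : ℤ => (z : ZMod p)) (key a b c)
    push_cast at this
    rw [← h3]
    simpa [hf] using this
  calc matMulTensor (ZMod p) k m n a b c
      = E * (((D ^ 3 : ℕ) : ZMod p) * matMulTensor (ZMod p) k m n a b c) := by
        rw [← mul_assoc, hE, one_mul]
    _ = E * ∑ i, f (W i a) * f (U i b) * f (V i c) := by rw [h4]
    _ = ∑ i, E * f (W i a) * f (U i b) * f (V i c) := by
        rw [Finset.mul_sum]
        exact Finset.sum_congr rfl fun i _ => by ring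


/-- `R_{𝔽̄_p}(⟨k,m,n⟩) ≤ R_{𝔽_p}(⟨k,m,n⟩) ≤ R_ℚ(⟨k,m,n⟩)` for all large primes `p`: the unconditional
`≤`-half of the route's item `FixedFormatContinuity` (18044), with `R_ℚ` in place of `R_ℂ`.
[folklore] -/
theorem tensorRank_algClosure_le_rat_eventually (k m n : ℕ) :
    ∃ p₀ : ℕ, ∀ (p : ℕ) [Fact p.Prime], p₀ ≤ p →
      tensorRank (matMulTensor (AlgebraicClosure (ZMod p)) k m n) ≤
        tensorRank (matMulTensor ℚ k m n) := by
  obtain ⟨p₀, hp₀⟩ := eventually_atTop.1 (tensorRank_zmod_le_rat_eventually k m n)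
  refine ⟨p₀, fun p inst hp => ?_⟩
  exact (tensorRank_matMulTensor_map_le (algebraMap (ZMod p) (AlgebraicClosure (ZMod p))) k m n).trans
    (hp₀ p hp inst.out)

/-! ## Upper semicontinuity of `ω` at characteristic zero (item 18041) -/

/-- `R_K(⟨n,n,n⟩) ≤ n^γ` (as reals) with `n ≥ 2` gives `ω(K) ≤ γ` (`ω(K) ≤ log_n R_K(⟨n,n,n⟩)`,
tree `advxxz2025_omega_le_logb_of_tensorRank_le`). [cite: Blaser2013, Def. 5.1] -/
theorem omega_le_of_tensorRank_le_rpow (K : Type) [Field K] {n : ℕ} (hn : 2 ≤ n) {γ : ℝ}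
    (h : (tensorRank (matMulTensor K n n n) : ℝ) ≤ (n : ℝ) ^ γ) : omega K ≤ γ := by
  have hn1 : (1 : ℝ) < n := by exact_mod_cast (lt_of_lt_of_le one_lt_two hn)
  have hpos : (0 : ℝ) < tensorRank (matMulTensor K n n n) := tensorRank_matMulTensor_pos K hn
  calc omega K ≤ Real.logb n (tensorRank (matMulTensor K n n n)) :=
        advxxz2025_omega_le_logb_of_tensorRank_le K hn le_rfl
    _ ≤ Real.logb n ((n : ℝ) ^ γ) := Real.logb_le_logb_of_le hn1 hpos h
    _ = γ := Real.logb_rpow (by positivity) hn1.ne'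


/-- For every `γ > ω(ℂ)`: one format `n ≥ 2` with `R_{𝔽̄_p}(⟨n,n,n⟩) ≤ n^γ` for all large primes
`p`. [cite: Blaser2013, Def. 5.1] -/
theorem exists_format_eventually {γ : ℝ} (hγ : omega ℂ < γ) :
    ∃ n : ℕ, 2 ≤ n ∧ ∃ p₀ : ℕ, ∀ (p : ℕ) [Fact p.Prime], p₀ ≤ p →
      (tensorRank (matMulTensor (AlgebraicClosure (ZMod p)) n n n) : ℝ) ≤ (n : ℝ) ^ γ := by
  rw [omega_eq_omega_rat (K := ℂ)] at hγ
  obtain ⟨N, hN, hlt⟩ := exists_tensorRank_matMulTensor_lt_rpow ℚ (θ := γ) hγ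
  obtain ⟨p₀, hp₀⟩ := tensorRank_algClosure_le_rat_eventually N N N
  refine ⟨N, hN, p₀, fun p inst hp => ?_⟩
  calc (tensorRank (matMulTensor (AlgebraicClosure (ZMod p)) N N N) : ℝ)
        ≤ tensorRank (matMulTensor ℚ N N N) := by exact_mod_cast hp₀ p hp
    _ ≤ (N : ℝ) ^ γ := hlt.le

/-- **Item `stmt-MatrixMultiplication-18041` (`LefschetzUpperBound`)**: for every `ε > 0`,
`ω(𝔽̄_p) ≤ ω(ℂ) + ε` for all large primes `p`. [cite: BurgisserClausenShokrollahi1997, Cor. (15.18)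
and Chap. 15 introduction] -/
theorem lefschetzUpperBound_holds : LefschetzUpperBound := by
  intro ε hε
  obtain ⟨n, hn, p₀, hp₀⟩ := exists_format_eventually (γ := omega ℂ + ε) (by linarith)
  refine ⟨p₀, fun p inst hp => ?_⟩
  exact omega_le_of_tensorRank_le_rpow (AlgebraicClosure (ZMod p)) hn (hp₀ p hp)

/-! ## Losslessness of the route's cut (item 18042) -/

/-- **Item `stmt-MatrixMultiplication-18042` (`Converse`)**: `ω(ℂ) = 2` implies
`LargeCharacteristicFast` (by `lefschetzUpperBound_holds`) and `ContinuityAtZero` (because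
`2 ≤ ω(𝔽̄_p)`, flattening). [cite: BurgisserClausenShokrollahi1997, Cor. (15.18)] -/
theorem converse_holds : Converse := by
  intro hS
  have h2 : omega ℂ = 2 := (_root_.MatrixMultiplication_iff).1 hS
  refine ⟨fun ε hε => ?_, fun ε hε => ⟨0, fun p inst _ => ?_⟩⟩
  · obtain ⟨p₀, hp₀⟩ := lefschetzUpperBound_holds ε hε
    refine ⟨p₀, fun p inst hp => ?_⟩
    have := hp₀ p hp
    rw [h2] at this
    exact this
  · have := omega_two_le (AlgebraicClosure (ZMod p))
    linarith

end Summit.MatrixMultiplication.MatrixMultiplication.Theorems.CharacteristicContinuityTransfer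

end
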